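import Mathlib.RingTheory.Etale.Weakly
import Mathlib.RingTheory.RingHom.Flat
import Literature.RingTheory.Flat.FibrewiseCriterionLemmas
import HarnessLib

/-!
# Cancellation of weakly étale ring maps (Gabber–Ramero 3.1.2 (iv), Bhatt–Scholze 2.3.3 (4))

A ring map `A → B` is *weakly étale* if `A → B` and `B ⊗_A B → B` are flat (Bhatt–Scholze
Def. 2.3.1, Mathlib `Algebra.WeaklyEtale`). Mathlib has composition and base change; this file adds
the **cancellation property** used in the proof of Bhatt–Scholze Thm. 2.3.4 ("the map `f'` is also
weakly étale since all other maps in the square are so"):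

* `weaklyEtale_cancel` — **if `A → B` and `A → C` are weakly étale, so is every `A`-algebra map
  `B → C`** (Gabber–Ramero, *Almost ring theory*, Lemma 3.1.2 (iv), in the classical limit;
  Bhatt–Scholze Prop. 2.3.3 (4)). Flatness of `B → C`: it is the composite
  `B → B ⊗_A C → B ⊗_B C ≅ C` of a base change of `A → C` and of the base change
  `B ⊗_A C → B ⊗_B C` of `B ⊗_A B → B` (Mathlib `RingHom.Flat.mapOfCompatibleSMul`),
  `flat_algebraMap_of_weaklyEtale_left`; flatness of `C ⊗_B C → C`: its composite with the flat
  surjection `C ⊗_A C → C ⊗_B C` is the flat `C ⊗_A C → C`, and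
* `ringHom_flat_of_comp_surjective` — a ring map out of a quotient ring `Q = P/I` is flat if its
  composite with `P → Q` is (the tree's `Literature.RingTheory.Flat.flat_of_flat_of_surjective`).

## References

* O. Gabber, L. Ramero, *Almost ring theory*, LNM 1800 (2003): Def. 3.1.1, Lemma 3.1.2 (iv)
  (held copy PDF pp. 71–72; §3.4.44 for the classical limit `𝔪 = V`). [GabberRamero2003]
* B. Bhatt, P. Scholze, *The pro-étale topology for schemes*, Astérisque 369 (2015)
  (arXiv:1309.1198): Def. 2.3.1, Prop. 2.3.3 (4) (p. 11, citing Gabber–Ramero). [BhattScholze2015]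

## Design notes

* Theorems only (D-0026). All rings in one universe `u` (Mathlib's
  `RingHom.Flat.mapOfCompatibleSMul` is universe-monomorphic in this way).
* Mathlib searched: `Algebra.WeaklyEtale` (base change, `trans`; no cancellation),
  `RingHom.Flat.comp_iff_of_bijective_left` (bijective, not surjective, first factor); reused from
  the tree: `Literature.RingTheory.Flat.flat_of_flat_of_surjective`. Nothing restated.
-/

universe u

open TensorProduct

namespace Literature.RingTheory.Etale

/-! ### Flatness of a ring map out of a quotient ring -/

section Surjective

variable {P Q : Type u} [CommRing P] [CommRing Q] [Algebra P Q]
  (hq : Function.Surjective (algebraMap P Q))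

include hq in
/-- **A ring map out of a quotient ring `Q = P/I` is flat if its composite with `P → Q` is**
(a `Q`-module flat over `P` is flat over `Q`, the tree's
`Literature.RingTheory.Flat.flat_of_flat_of_surjective`). [folklore] -/
theorem ringHom_flat_of_comp_surjective {T : Type u} [CommRing T] (g : Q →+* T)
    (h : (g.comp (algebraMap P Q)).Flat) : g.Flat := by
  letI : Algebra Q T := g.toAlgebra
  letI : Algebra P T := (g.comp (algebraMap P Q)).toAlgebra
  haveI : IsScalarTower P Q T := IsScalarTower.of_algebraMap_eq fun _ => rfl
  haveI : Module.Flat P T := h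
  exact Literature.RingTheory.Flat.flat_of_flat_of_surjective hq T

end Surjective

/-! ### Cancellation of weakly étale maps (Gabber–Ramero 3.1.2 (iv); Bhatt–Scholze 2.3.3 (4)) -/

section Cancel

variable (A B C : Type u) [CommRing A] [CommRing B] [CommRing C] [Algebra A B] [Algebra B C]
  [Algebra A C] [IsScalarTower A B C]

/-- The `B`-algebra map `B ⊗[A] C → C` is flat when `B ⊗[A] B → B` is (it is the base change
`B ⊗[A] C → B ⊗[B] C ≅ C`, Mathlib `RingHom.Flat.mapOfCompatibleSMul`). [folklore] -/
theorem flat_algebraMap_of_weaklyEtale_left [Algebra.WeaklyEtale A B] [Module.Flat A C] :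
    Module.Flat B C := by
  have h1 : (Algebra.TensorProduct.mapOfCompatibleSMul B A B B C).Flat :=
    RingHom.Flat.mapOfCompatibleSMul B C (Algebra.WeaklyEtale.flat_lmul' A B)
  have h2 : ((Algebra.TensorProduct.lid B C).toAlgHom.toRingHom).Flat :=
    .of_bijective (Algebra.TensorProduct.lid B C).bijective
  have h3 : (algebraMap B (B ⊗[A] C)).Flat := RingHom.flat_algebraMap_iff.2 inferInstance
  have heq : algebraMap B C =
      (((Algebra.TensorProduct.lid B C).toAlgHom.toRingHom).comp
        (Algebra.TensorProduct.mapOfCompatibleSMul B A B B C).toRingHom).comp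
        (algebraMap B (B ⊗[A] C)) := by
    ext b
    simp [Algebra.algebraMap_eq_smul_one]
  rw [← RingHom.flat_algebraMap_iff, heq]
  exact (h3.comp h1).comp h2

/-- **Cancellation for weakly étale maps** (Gabber–Ramero Lemma 3.1.2 (iv), Bhatt–Scholze
Prop. 2.3.3 (4)): if `A → B` and `A → C` are weakly étale, so is any `A`-algebra map `B → C`.
Flatness: `B → B ⊗[A] C → B ⊗[B] C ≅ C`; diagonal: `C ⊗[B] C → C` is flat because its composite
with the flat surjection `C ⊗[A] C → C ⊗[B] C` is the flat `C ⊗[A] C → C`.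
[cite: GabberRamero2003, Lemma 3.1.2 (iv); BhattScholze2015, Prop. 2.3.3 (4)] -/
theorem weaklyEtale_cancel [Algebra.WeaklyEtale A B] [Algebra.WeaklyEtale A C] :
    Algebra.WeaklyEtale B C where
  flat := flat_algebraMap_of_weaklyEtale_left A B C
  flat_lmul' := by
    -- `q : C ⊗[A] C → C ⊗[B] C` is surjective and `lmul'_A = lmul'_B ∘ q`
    let q := Algebra.TensorProduct.mapOfCompatibleSMul B A C C C
    have hq : Function.Surjective q := Algebra.TensorProduct.mapOfCompatibleSMul_surjective B A C C C
    letI : Algebra (C ⊗[A] C) (C ⊗[B] C) := q.toRingHom.toAlgebra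
    have hcomp : (Algebra.TensorProduct.lmul' B (S := C)).toRingHom.comp (algebraMap (C ⊗[A] C) (C ⊗[B] C)) =
        (Algebra.TensorProduct.lmul' A (S := C)).toRingHom := by
      ext c
      · rfl
      · rfl
    refine ringHom_flat_of_comp_surjective (P := C ⊗[A] C) hq _ ?_
    rw [hcomp]
    exact Algebra.WeaklyEtale.flat_lmul' A C

end Cancel

end Literature.RingTheory.Etale
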